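import Mathlib.RingTheory.IsTensorProduct
import Mathlib.Algebra.Algebra.Rat
import Mathlib.Algebra.Algebra.Hom.Rat
import HarnessLib

/-!
# The semilinear automorphisms `Θ_θ` of an abstract base change `j₀ : M₀ → M` to a field `L ⊇ ℚ`

Topic `Literature/LinearAlgebra/BaseChange` (namespace `Literature.LinearAlgebra.BaseChange`).  THEOREMS ONLY (Mathlib only; no
definition, no named fact, no instance, no `sorry`).  Abstract-base-change twin of ★ `SemilinearAutRankTransport` §2 (which treats the
concrete model `ℂ ⊗_ℚ V` and the maps `τ ⊗ 1`): here the extension of scalars is given only through Mathlib's universal property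
`IsBaseChange L j₀` for a `ℚ`-linear `j₀ : M₀ → M` into an `L`-vector space `M` (`M ≃ L ⊗_ℚ M₀`, `IsBaseChange.equiv`), and `θ` is ANY
ring automorphism of the field `L` (automatically a `ℚ`-algebra automorphism, `RingHom.map_rat_algebraMap`).

MATHEMATICS ([BourbakiAlgebraI1989] Ch. II §5 no. 1 (extension of scalars; Prop. 4: `1 ⊗ (basis)` is a basis) with Ch. II §1 no. 13
(semi-linear maps); [Milne2017] Ch. 4 §i, Prop. 4.31 / Cor. 4.34 (the `Aut(k′/k)`-action on a base change and its equivariance)):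
transporting `θ ⊗ 1 : L ⊗_ℚ M₀ → L ⊗_ℚ M₀` along `IsBaseChange.equiv : L ⊗_ℚ M₀ ≃ M` gives an additive bijection `Θ = Θ_θ : M ≃ M` which is
**θ-SEMILINEAR** (`Θ (z • m) = θ z • Θ m`) and **FIXES THE `ℚ`-FORM** (`Θ (j₀ v) = j₀ v`); such a `Θ` is UNIQUE, because two θ-semilinear
additive maps agreeing on `range j₀` agree on its `L`-span `M`; consequently `Θ` **commutes with every `L`-linear endomorphism `E` of `M`
defined over `ℚ`** (`E ∘ j₀ = j₀ ∘ e₀`), and twists the scalar multiples `z • E` to `θ z • E`.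

CONTENT: §1 `semilinear_addMonoidHom_ext_of_isBaseChange` (the extension principle); §2 **`exists_semilinear_addEquiv_of_isBaseChange`**
(existence of `Θ_θ`), `semilinear_addEquiv_eq_of_eqOn_range` (uniqueness), `semilinear_addEquiv_symm_smul` / `semilinear_addEquiv_symm_apply_eq`
(the inverse is `θ⁻¹`-semilinear and fixes the `ℚ`-form); §3 **`semilinear_apply_comm_of_isBaseChange`** (`Θ (E m) = E (Θ m)`),
`semilinear_apply_smul_comm_of_isBaseChange` (`Θ ((z • E) m) = (θ z • E) (Θ m)`), `semilinear_apply_sum_smul_comm_of_isBaseChange`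
(finite sums `Σ z_k • E_k ↦ Σ θ(z_k) • E_k`), `semilinear_symm_apply_comm_of_isBaseChange`; §4 (ed. 2) `exists_semilinearEquiv_of_isBaseChange`
(`Θ_θ` packaged as a Mathlib `M ≃ₛₗ[θ] M`), **`semilinear_apply_tensorMap_comm_of_isBaseChange`** (`Θ (Φ x m) = Φ ((θ ⊗ id) x) (Θ m)` for the
realised action `Φ` of `L ⊗_ℚ A`, ALL `x`), `tensorMap_apply_semilinear_eq_self_of_isBaseChange` /
`image_semilinear_setOf_tensorMap_apply_eq_self_of_isBaseChange` (blocks `{m | Φ c m = m}` go to the blocks of `(θ ⊗ id) c`).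

USE (cell `hodgecm-mathlib`, D-0151, crux `HLiu418` = stmt-HodgeConjecture-24832, d6 card S2′ degree road, the (MO) producer of A-p05 (g12),
piece (F2′)): `L := ℚ̄_ℓ`, `M₀ := (ℚ^ι)^∨` (the dual of the rational representation of ★ `RationalRepresentationTateComparison`),
`M := ℚ̄_ℓ ⊗_{ℚ_ℓ} (V_ℓ A_K)^∨`, `j₀ :=` the dual Tate comparison (`IsBaseChange ℚ̄_ℓ j₀`, A-p08 (g12)), `E := ᵗV_ℓ(h) ⊗ 1`,
`e₀ := ᵗψ(h)`: every `θ ∈ Aut(ℚ̄_ℓ)` lifts to a θ-semilinear bijection of `ℚ̄_ℓ ⊗ H¹_ét(A_K)` commuting with the realised endomorphisms and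
twisting the realised `ℚ̄_ℓ ⊗_ℚ End⁰(A_K)`-scalars by `θ ⊗ 1`.  HC_CM is proved only modulo the 7 printed citations until rung 0 closes;
nothing here moves a book.

## References
* [BourbakiAlgebraI1989] N. Bourbaki, *Algebra I, Chapters 1–3*, Springer (1989), Ch. II §1 no. 13 and §5 no. 1.
* [Milne2017] J. S. Milne, *Algebraic Groups*, CUP (2017), Ch. 4 §i, Prop. 4.31 and Cor. 4.34.
-/

set_option autoImplicit false

noncomputable section

open scoped TensorProduct

namespace Literature.LinearAlgebra.BaseChange

variable {L : Type*} [Field L] [Algebra ℚ L]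
variable {M₀ : Type*} [AddCommGroup M₀] [Module ℚ M₀]
variable {M : Type*} [AddCommGroup M] [Module L M] [Module ℚ M] [IsScalarTower ℚ L M]
variable {j₀ : M₀ →ₗ[ℚ] M} (hj₀ : IsBaseChange L j₀) (θ : L ≃+* L)

/-! ## §1 The extension principle: θ-semilinear additive maps are determined on the `ℚ`-form -/

section Ext

variable {N : Type*} [AddCommGroup N] [Module L N]

include hj₀ in
/-- **Extension principle.**  Two additive maps `f, g : M → N` into an `L`-module which are both θ-semilinear
(`f (z • m) = θ z • f m`) and agree on the `ℚ`-form `range j₀` are equal: `M` is the `L`-span of `j₀(M₀)`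
(`IsBaseChange.equiv` is onto and `equiv (a ⊗ v) = a • j₀ v`). [cite: BourbakiAlgebraI1989, Ch. II §1 no. 13 and §5 no. 1 (p0379)] -/
theorem semilinear_addMonoidHom_ext_of_isBaseChange (f g : M →+ N)
    (hf : ∀ (z : L) (m : M), f (z • m) = θ z • f m) (hg : ∀ (z : L) (m : M), g (z • m) = θ z • g m)
    (h : ∀ v : M₀, f (j₀ v) = g (j₀ v)) : f = g := by
  ext m
  obtain ⟨t, rfl⟩ := hj₀.equiv.surjective m
  induction t using TensorProduct.induction_on with
  | zero => rw [map_zero, map_zero, map_zero]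
  | tmul a v => rw [IsBaseChange.equiv_tmul, hf, hg, h]
  | add x y hx hy => rw [map_add, map_add, map_add, hx, hy]

include hj₀ in
/-- Pointwise form of `semilinear_addMonoidHom_ext_of_isBaseChange` for bare functions that are additive.
[cite: BourbakiAlgebraI1989, Ch. II §1 no. 13 and §5 no. 1 (p0379)] -/
theorem semilinear_apply_eq_of_isBaseChange (f g : M →+ N)
    (hf : ∀ (z : L) (m : M), f (z • m) = θ z • f m) (hg : ∀ (z : L) (m : M), g (z • m) = θ z • g m)
    (h : ∀ v : M₀, f (j₀ v) = g (j₀ v)) (m : M) : f m = g m :=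
  DFunLike.congr_fun (semilinear_addMonoidHom_ext_of_isBaseChange hj₀ θ f g hf hg h) m

end Ext

/-! ## §2 Existence and uniqueness of `Θ_θ` -/

include hj₀ in
/-- **Existence of `Θ_θ`.**  For a base change `j₀ : M₀ → M` to `L` (`IsBaseChange L j₀`) and a ring automorphism `θ` of the
field `L`, there is an additive bijection `Θ : M ≃ M` which is θ-semilinear and fixes the `ℚ`-form `j₀(M₀)` pointwise:
`Θ := IsBaseChange.equiv ∘ (θ ⊗ 1) ∘ IsBaseChange.equiv⁻¹` with `θ ⊗ 1 = LinearEquiv.rTensor M₀ θ_ℚ`, `θ_ℚ` the `ℚ`-algebra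
automorphism underlying `θ` (`AlgEquiv.ofRingEquiv`, `RingHom.map_rat_algebraMap`).
[cite: Milne2017, Prop. 4.31 and Cor. 4.34] [cite: BourbakiAlgebraI1989, Ch. II §5 no. 1 (p0379)] -/
theorem exists_semilinear_addEquiv_of_isBaseChange :
    ∃ Θ : M ≃+ M, (∀ (z : L) (m : M), Θ (z • m) = θ z • Θ m) ∧ ∀ v : M₀, Θ (j₀ v) = j₀ v := by
  let θℚ : L ≃ₐ[ℚ] L := AlgEquiv.ofRingEquiv (f := θ) (θ.toRingHom.map_rat_algebraMap)
  let T : L ⊗[ℚ] M₀ ≃ₗ[ℚ] L ⊗[ℚ] M₀ := LinearEquiv.rTensor M₀ θℚ.toLinearEquiv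
  have hT : ∀ (a : L) (v : M₀), T (a ⊗ₜ[ℚ] v) = θ a ⊗ₜ[ℚ] v := fun a v => rfl
  have hTsmul : ∀ (z : L) (t : L ⊗[ℚ] M₀), T (z • t) = θ z • T t := by
    intro z t
    induction t using TensorProduct.induction_on with
    | zero => rw [smul_zero, map_zero, smul_zero]
    | tmul a v =>
      rw [TensorProduct.smul_tmul', smul_eq_mul, hT, hT, map_mul, TensorProduct.smul_tmul', smul_eq_mul]
    | add x y hx hy => rw [smul_add, map_add, map_add, hx, hy, smul_add]
  refine ⟨(hj₀.equiv.toAddEquiv.symm.trans T.toAddEquiv).trans hj₀.equiv.toAddEquiv, fun z m => ?_, fun v => ?_⟩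
  · obtain ⟨t, rfl⟩ := hj₀.equiv.surjective m
    change hj₀.equiv (T (hj₀.equiv.symm (z • hj₀.equiv t))) = θ z • hj₀.equiv (T (hj₀.equiv.symm (hj₀.equiv t)))
    rw [← map_smul, LinearEquiv.symm_apply_apply, LinearEquiv.symm_apply_apply, hTsmul, map_smul]
  · change hj₀.equiv (T (hj₀.equiv.symm (j₀ v))) = j₀ v
    rw [IsBaseChange.equiv_symm_apply, hT, map_one, IsBaseChange.equiv_tmul, one_smul]

include hj₀ in
/-- **Uniqueness of `Θ_θ`**: two θ-semilinear additive bijections of `M` fixing `j₀(M₀)` pointwise coincide.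
[cite: BourbakiAlgebraI1989, Ch. II §1 no. 13 and §5 no. 1 (p0379)] -/
theorem semilinear_addEquiv_eq_of_eqOn_range (Θ Θ' : M ≃+ M)
    (hΘ : ∀ (z : L) (m : M), Θ (z • m) = θ z • Θ m) (hΘj : ∀ v : M₀, Θ (j₀ v) = j₀ v)
    (hΘ' : ∀ (z : L) (m : M), Θ' (z • m) = θ z • Θ' m) (hΘ'j : ∀ v : M₀, Θ' (j₀ v) = j₀ v) : Θ = Θ' :=
  AddEquiv.ext fun m =>
    semilinear_apply_eq_of_isBaseChange hj₀ θ Θ.toAddMonoidHom Θ'.toAddMonoidHom hΘ hΘ'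
      (fun v => (hΘj v).trans (hΘ'j v).symm) m

omit [Algebra ℚ L] [Module ℚ M] [IsScalarTower ℚ L M] in
/-- The inverse of a θ-semilinear additive bijection is `θ⁻¹`-semilinear. [cite: BourbakiAlgebraI1989, Ch. II §1 no. 13] -/
theorem semilinear_addEquiv_symm_smul (Θ : M ≃+ M) (hΘ : ∀ (z : L) (m : M), Θ (z • m) = θ z • Θ m)
    (z : L) (m : M) : Θ.symm (z • m) = θ.symm z • Θ.symm m :=
  Θ.injective <| by rw [Θ.apply_symm_apply, hΘ, θ.apply_symm_apply, Θ.apply_symm_apply]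

/-- The inverse of an additive bijection fixing `j₀(M₀)` pointwise fixes it pointwise. [cite: BourbakiAlgebraI1989, Ch. II §1 no. 13] -/
theorem semilinear_addEquiv_symm_apply_eq (Θ : M ≃+ M) (hΘj : ∀ v : M₀, Θ (j₀ v) = j₀ v) (v : M₀) :
    Θ.symm (j₀ v) = j₀ v :=
  Θ.injective <| by rw [Θ.apply_symm_apply, hΘj]

/-! ## §3 `Θ_θ` commutes with endomorphisms defined over `ℚ` and twists scalars by `θ` -/

include hj₀ in
/-- **`Θ_θ` commutes with every `L`-linear endomorphism defined over `ℚ`.**  If `Θ : M ≃ M` is θ-semilinear and fixes `j₀(M₀)`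
pointwise, and `E : M →ₗ[L] M` satisfies `E ∘ j₀ = j₀ ∘ e₀` for some `ℚ`-linear `e₀ : M₀ → M₀` (i.e. `E = e₀ ⊗ 1` is the base change
of `e₀`), then `Θ (E m) = E (Θ m)` for all `m` — both sides are θ-semilinear additive in `m` and agree on `j₀(M₀)`.
[cite: Milne2017, Prop. 4.31 and Cor. 4.34] [cite: BourbakiAlgebraI1989, Ch. II §5 no. 1 (p0379)] -/
theorem semilinear_apply_comm_of_isBaseChange (Θ : M ≃+ M) (hΘ : ∀ (z : L) (m : M), Θ (z • m) = θ z • Θ m)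
    (hΘj : ∀ v : M₀, Θ (j₀ v) = j₀ v) (E : M →ₗ[L] M) (e₀ : M₀ →ₗ[ℚ] M₀) (hE : ∀ v : M₀, E (j₀ v) = j₀ (e₀ v))
    (m : M) : Θ (E m) = E (Θ m) :=
  semilinear_apply_eq_of_isBaseChange hj₀ θ (Θ.toAddMonoidHom.comp E.toAddMonoidHom)
    (E.toAddMonoidHom.comp Θ.toAddMonoidHom)
    (fun z m' => show Θ (E (z • m')) = θ z • Θ (E m') by rw [map_smul, hΘ])
    (fun z m' => show E (Θ (z • m')) = θ z • E (Θ m') by rw [hΘ, map_smul])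
    (fun v => show Θ (E (j₀ v)) = E (Θ (j₀ v)) by rw [hE, hΘj, hΘj, hE]) m

include hj₀ in
/-- **`Θ_θ` twists scalar multiples of endomorphisms defined over `ℚ` by `θ`**: `Θ ((z • E) m) = (θ z • E) (Θ m)` — the action of a
realised scalar `z ⊗ e₀` is carried to that of `θ z ⊗ e₀`. [cite: Milne2017, Prop. 4.31 and Cor. 4.34] -/
theorem semilinear_apply_smul_comm_of_isBaseChange (Θ : M ≃+ M) (hΘ : ∀ (z : L) (m : M), Θ (z • m) = θ z • Θ m)
    (hΘj : ∀ v : M₀, Θ (j₀ v) = j₀ v) (E : M →ₗ[L] M) (e₀ : M₀ →ₗ[ℚ] M₀) (hE : ∀ v : M₀, E (j₀ v) = j₀ (e₀ v))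
    (z : L) (m : M) : Θ ((z • E) m) = (θ z • E) (Θ m) := by
  rw [LinearMap.smul_apply, LinearMap.smul_apply, hΘ, semilinear_apply_comm_of_isBaseChange hj₀ θ Θ hΘ hΘj E e₀ hE]

include hj₀ in
/-- **Finite sums**: `Θ ((Σ_k z_k • E_k) m) = (Σ_k θ(z_k) • E_k) (Θ m)` for endomorphisms `E_k` defined over `ℚ` — the realised action of
`x = Σ z_k ⊗ e_k ∈ L ⊗_ℚ End(M₀)` is carried by `Θ_θ` to that of `(θ ⊗ id) x`. [cite: Milne2017, Prop. 4.31 and Cor. 4.34] -/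
theorem semilinear_apply_sum_smul_comm_of_isBaseChange (Θ : M ≃+ M) (hΘ : ∀ (z : L) (m : M), Θ (z • m) = θ z • Θ m)
    (hΘj : ∀ v : M₀, Θ (j₀ v) = j₀ v) {κ : Type*} (s : Finset κ) (z : κ → L) (E : κ → M →ₗ[L] M) (e₀ : κ → M₀ →ₗ[ℚ] M₀)
    (hE : ∀ (k : κ) (v : M₀), E k (j₀ v) = j₀ (e₀ k v)) (m : M) :
    Θ ((∑ k ∈ s, z k • E k) m) = (∑ k ∈ s, θ (z k) • E k) (Θ m) := by
  rw [LinearMap.sum_apply, LinearMap.sum_apply, map_sum]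
  exact Finset.sum_congr rfl fun k _ => semilinear_apply_smul_comm_of_isBaseChange hj₀ θ Θ hΘ hΘj (E k) (e₀ k) (hE k) (z k) m

include hj₀ in
/-- The inverse `Θ_θ⁻¹` also commutes with every endomorphism defined over `ℚ`. [cite: Milne2017, Prop. 4.31 and Cor. 4.34] -/
theorem semilinear_symm_apply_comm_of_isBaseChange (Θ : M ≃+ M) (hΘ : ∀ (z : L) (m : M), Θ (z • m) = θ z • Θ m)
    (hΘj : ∀ v : M₀, Θ (j₀ v) = j₀ v) (E : M →ₗ[L] M) (e₀ : M₀ →ₗ[ℚ] M₀) (hE : ∀ v : M₀, E (j₀ v) = j₀ (e₀ v))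
    (m : M) : Θ.symm (E m) = E (Θ.symm m) :=
  Θ.injective <| by
    rw [Θ.apply_symm_apply, semilinear_apply_comm_of_isBaseChange hj₀ θ Θ hΘ hΘj E e₀ hE, Θ.apply_symm_apply]

include hj₀ in
/-- **Images of `ℚ`-rational endomorphisms are `Θ_θ`-stable**: `Θ` maps `range E` onto `range E` when `E` is defined over `ℚ`.
[cite: Milne2017, Prop. 4.31 and Cor. 4.34] -/
theorem semilinear_apply_mem_range_of_isBaseChange (Θ : M ≃+ M) (hΘ : ∀ (z : L) (m : M), Θ (z • m) = θ z • Θ m)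
    (hΘj : ∀ v : M₀, Θ (j₀ v) = j₀ v) (E : M →ₗ[L] M) (e₀ : M₀ →ₗ[ℚ] M₀) (hE : ∀ v : M₀, E (j₀ v) = j₀ (e₀ v))
    {y : M} (hy : y ∈ LinearMap.range E) : Θ y ∈ LinearMap.range E := by
  obtain ⟨m, rfl⟩ := hy
  exact ⟨Θ m, (semilinear_apply_comm_of_isBaseChange hj₀ θ Θ hΘ hΘj E e₀ hE m).symm⟩

include hj₀ in
/-- **Fixed vectors of `ℚ`-rational endomorphisms are `Θ_θ`-stable**: if `E m = m` then `E (Θ m) = Θ m`.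
[cite: Milne2017, Prop. 4.31 and Cor. 4.34] -/
theorem semilinear_apply_eq_self_of_isBaseChange (Θ : M ≃+ M) (hΘ : ∀ (z : L) (m : M), Θ (z • m) = θ z • Θ m)
    (hΘj : ∀ v : M₀, Θ (j₀ v) = j₀ v) (E : M →ₗ[L] M) (e₀ : M₀ →ₗ[ℚ] M₀) (hE : ∀ v : M₀, E (j₀ v) = j₀ (e₀ v))
    {m : M} (hm : E m = m) : E (Θ m) = Θ m := by
  rw [← semilinear_apply_comm_of_isBaseChange hj₀ θ Θ hΘ hΘj E e₀ hE m, hm]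

/-! ## §4 (ed. 2) Packaging as `M ≃ₛₗ[θ] M`, and the realised action of `L ⊗_ℚ A` is twisted by `θ ⊗ id` -/

include hj₀ in
/-- **`Θ_θ` as a Mathlib semilinear equivalence `M ≃ₛₗ[θ] M`** fixing the `ℚ`-form, for consumers holding the `RingHomInvPair`
instances of `θ` (supply them with `RingHomInvPair.of_ringEquiv θ` and `RingHomInvPair.of_ringEquiv_symm θ`); θ-semilinearity is then
Mathlib's `map_smulₛₗ`. [cite: Milne2017, Prop. 4.31 and Cor. 4.34] [cite: BourbakiAlgebraI1989, Ch. II §5 no. 1 (p0379)] -/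
theorem exists_semilinearEquiv_of_isBaseChange
    [RingHomInvPair (θ : L →+* L) (θ.symm : L →+* L)] [RingHomInvPair (θ.symm : L →+* L) (θ : L →+* L)] :
    ∃ Θ : M ≃ₛₗ[(θ : L →+* L)] M, ∀ v : M₀, Θ (j₀ v) = j₀ v := by
  obtain ⟨Θ, hΘ, hΘj⟩ := exists_semilinear_addEquiv_of_isBaseChange hj₀ θ
  exact ⟨{ Θ with map_smul' := hΘ }, hΘj⟩

include hj₀ in
/-- **The realised action of `L ⊗_ℚ A` is twisted by `θ ⊗ id`.**  Let a `ℚ`-algebra `A` act on `M` through an `L`-linear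
`Φ : L ⊗_ℚ A → End_L(M)` whose values on `1 ⊗ a` are defined over `ℚ` (`Φ (1 ⊗ a) ∘ j₀ = j₀ ∘ e₀ a`).  Then for EVERY
`x ∈ L ⊗_ℚ A` (not only pure tensors), `Θ (Φ x m) = Φ ((θ ⊗ id) x) (Θ m)`, `θ ⊗ id = Algebra.TensorProduct.map θ_ℚ (AlgHom.id ℚ A)` —
i.e. `Θ_θ` is `(θ ⊗ id)`-semilinear for the `L ⊗_ℚ A`-module structure `x • m := Φ x m`.  (With `A` an algebra of `ℚ`-rational
endomorphisms and `(c_i)` the central idempotents of `L ⊗_ℚ A`, this carries the block `{m | Φ c_i m = m}` onto the block of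
`(θ ⊗ id) c_i`.) [cite: Milne2017, Prop. 4.31 and Cor. 4.34] [cite: BourbakiAlgebraI1989, Ch. II §5 no. 1 (p0379)] -/
theorem semilinear_apply_tensorMap_comm_of_isBaseChange (Θ : M ≃+ M) (hΘ : ∀ (z : L) (m : M), Θ (z • m) = θ z • Θ m)
    (hΘj : ∀ v : M₀, Θ (j₀ v) = j₀ v) {A : Type*} [Ring A] [Algebra ℚ A]
    (Φ : L ⊗[ℚ] A →ₗ[L] (M →ₗ[L] M)) (e₀ : A → (M₀ →ₗ[ℚ] M₀))
    (hΦ : ∀ (a : A) (v : M₀), Φ ((1 : L) ⊗ₜ[ℚ] a) (j₀ v) = j₀ (e₀ a v)) (x : L ⊗[ℚ] A) (m : M) :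
    Θ (Φ x m) = Φ (Algebra.TensorProduct.map θ.toRingHom.toRatAlgHom (AlgHom.id ℚ A) x) (Θ m) := by
  induction x using TensorProduct.induction_on generalizing m with
  | zero => simp only [map_zero, LinearMap.zero_apply]
  | tmul z a =>
    have hza : z ⊗ₜ[ℚ] a = z • ((1 : L) ⊗ₜ[ℚ] a) := by
      rw [TensorProduct.smul_tmul', smul_eq_mul, mul_one]
    have hθza : Algebra.TensorProduct.map θ.toRingHom.toRatAlgHom (AlgHom.id ℚ A) (z ⊗ₜ[ℚ] a) = θ z • ((1 : L) ⊗ₜ[ℚ] a) := by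
      rw [Algebra.TensorProduct.map_tmul, AlgHom.id_apply, TensorProduct.smul_tmul', smul_eq_mul, mul_one]
      rfl
    rw [hθza, hza, map_smul, map_smul]
    exact semilinear_apply_smul_comm_of_isBaseChange hj₀ θ Θ hΘ hΘj (Φ ((1 : L) ⊗ₜ[ℚ] a)) (e₀ a) (hΦ a) z m
  | add x y hx hy => simp only [map_add, LinearMap.add_apply, hx, hy]

include hj₀ in
/-- Fixed-vector form of `semilinear_apply_tensorMap_comm_of_isBaseChange`: `Θ_θ` carries the vectors fixed by `Φ c` to vectors
fixed by `Φ ((θ ⊗ id) c)` — e.g. the block of a central idempotent `c` of `L ⊗_ℚ A` to the block of its `θ`-conjugate.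
[cite: Milne2017, Prop. 4.31 and Cor. 4.34] -/
theorem tensorMap_apply_semilinear_eq_self_of_isBaseChange (Θ : M ≃+ M) (hΘ : ∀ (z : L) (m : M), Θ (z • m) = θ z • Θ m)
    (hΘj : ∀ v : M₀, Θ (j₀ v) = j₀ v) {A : Type*} [Ring A] [Algebra ℚ A]
    (Φ : L ⊗[ℚ] A →ₗ[L] (M →ₗ[L] M)) (e₀ : A → (M₀ →ₗ[ℚ] M₀))
    (hΦ : ∀ (a : A) (v : M₀), Φ ((1 : L) ⊗ₜ[ℚ] a) (j₀ v) = j₀ (e₀ a v)) (c : L ⊗[ℚ] A) {m : M} (hm : Φ c m = m) :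
    Φ (Algebra.TensorProduct.map θ.toRingHom.toRatAlgHom (AlgHom.id ℚ A) c) (Θ m) = Θ m := by
  rw [← semilinear_apply_tensorMap_comm_of_isBaseChange hj₀ θ Θ hΘ hΘj Φ e₀ hΦ c m, hm]

include hj₀ in
/-- Set form: `Θ_θ '' {m | Φ c m = m} = {m | Φ ((θ ⊗ id) c) m = m}` (`Θ_θ` is a bijection and `Θ_θ⁻¹` is `θ⁻¹`-semilinear).
[cite: Milne2017, Prop. 4.31 and Cor. 4.34] -/
theorem image_semilinear_setOf_tensorMap_apply_eq_self_of_isBaseChange (Θ : M ≃+ M)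
    (hΘ : ∀ (z : L) (m : M), Θ (z • m) = θ z • Θ m) (hΘj : ∀ v : M₀, Θ (j₀ v) = j₀ v) {A : Type*} [Ring A] [Algebra ℚ A]
    (Φ : L ⊗[ℚ] A →ₗ[L] (M →ₗ[L] M)) (e₀ : A → (M₀ →ₗ[ℚ] M₀))
    (hΦ : ∀ (a : A) (v : M₀), Φ ((1 : L) ⊗ₜ[ℚ] a) (j₀ v) = j₀ (e₀ a v)) (c : L ⊗[ℚ] A) :
    Θ '' {m : M | Φ c m = m} = {m : M | Φ (Algebra.TensorProduct.map θ.toRingHom.toRatAlgHom (AlgHom.id ℚ A) c) m = m} := by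
  ext y
  simp only [Set.mem_image, Set.mem_setOf_eq]
  constructor
  · rintro ⟨m, hm, rfl⟩
    exact tensorMap_apply_semilinear_eq_self_of_isBaseChange hj₀ θ Θ hΘ hΘj Φ e₀ hΦ c hm
  · intro hy
    refine ⟨Θ.symm y, Θ.injective ?_, Θ.apply_symm_apply y⟩
    rw [Θ.apply_symm_apply, semilinear_apply_tensorMap_comm_of_isBaseChange hj₀ θ Θ hΘ hΘj Φ e₀ hΦ c (Θ.symm y),
      Θ.apply_symm_apply, hy]

end Literature.LinearAlgebra.BaseChange

end
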